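import Summits.Ventures.PercRepro.Night2NearFatReduce

/-!
# night-2: THE THREE-PLANE DICHOTOMY OF THE LOADS (gen 40)

A loaded target is a good target `Q_b ∪ {x}` (`x` in the closure of at most one thin face of the lossy big set `Q_b`) or,
when `Q_b` has NO good point, a distance-2 target (gen 32's `exists_pair_of_dload_ne_zero'`).  The thin faces of `Q_b` are
the erasures of its three off-coloop coloops `c, d, e` (gen 30's `thinFacesOf_eq_image_erase`), `Q_b ∖ K = R ∪ {c, d, e}`
with `R` a rank-2 set (gen 32's `exists_rank_two_of_loss_ne_zero`); two face closures meet in the PLANE through `R` and the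
third coloop (`mem_clF_sdiff_of_mem_two_faces`: `rk (cl A ∩ cl B) ≤ 5 + 5 − 6 = 4` by submodularity, and the plane plus the
coloop `e₀` has rank `4`).  A point in no good position lies in two faces, hence on one of the three planes: **with no good
point, `V` is covered by three planes through the line of `R`** (`threePlanar_of_gtPts_eq_empty`).  Hence, unless `V` is
THREE-PLANAR (stated inline: a rank-2 `R ⊆ V` and `c, d, e ∈ V` with `V ⊆ cl (R ∪ c) ∪ cl (R ∪ d) ∪ cl (R ∪ e)`), every load is a distance-1 load (`exists_good_of_dload_ne_zero_of_not_threePlanar`), its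
rank-2 set has `|T′| = |R| + 4` (`exists_rank_two_card_of_dload_ne_zero_of_not_threePlanar`), and a target of a basis
pair whose `Y` has `≤ |Y| − 2` points on every basis line and is inside no line through a basis point is UNLOADED
(`dload_eq_zero_of_not_threePlanar_of_shape` — THE SHAPE LEMMA of the non-three-planar case).
Paper: proofs/NIGHT-2-g40.md §1.
-/

namespace PercRepro.Shadow

open PercRepro.ThmH PercRepro.PerFlat

variable {α : Type*} [DecidableEq α] {M : Matroid α} [M.Finite] {G : Finset α}

/-- The coloops of the off-coloop part of a lossy big set are exactly the points off its rank-2 set. -/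
theorem coloops_eq_sdiff_of_loss_ne_zero (hG : G ∈ flatsQ M (5 + 1)) (hd : (gr M \ G).card = 2)
    (hk : kColoops M G = 1) (hs : ∀ e ∈ gr M, ∀ f ∈ gr M, e ≠ f → rkN M {e, f} = 2)
    (hl : ∀ e ∈ gr M, M.Indep {e}) {B : Finset α} (hB : B ∈ thinMembers M 5 G)
    (hbig : 5 ≤ (B \ coloops M G).card) {z : α} (hz : z ∈ G \ clF M B) (hloss : loss M 5 G B z ≠ 0)
    {R : Finset α} (hRQ : R ⊆ insert z B \ coloops M G) (hR2 : rkN M R = 2)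
    (hRcard : R.card + 3 = (insert z B \ coloops M G).card) :
    coloops M (insert z B \ coloops M G) = (insert z B \ coloops M G) \ R := by
  have h3 := card_coloops_eq_three_of_loss_ne_zero hG hd hk hs hl hB hbig hz hloss
  have hGg : G ⊆ gr M := (mem_flatsQ.1 hG).1
  have hQG : insert z B ⊆ G :=
    Finset.insert_subset (Finset.mem_sdiff.1 hz).1 (subset_G_of_mem_thinMembers hB)
  have hQ'g : insert z B \ coloops M G ⊆ gr M := Finset.sdiff_subset.trans (hQG.trans hGg)
  have hRg : R ⊆ gr M := hRQ.trans hQ'g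
  have hzB : z ∉ B := fun h => (Finset.mem_sdiff.1 hz).2 (subset_clF_of_subset_gr ((subset_G_of_mem_thinMembers hB).trans hGg) h)
  have hzK : z ∉ coloops M G := fun h => hzB (coloops_subset_of_mem_thinMembers hG (by omega) hB h)
  have hQ'card : 6 ≤ (insert z B \ coloops M G).card := by
    rw [insert_sdiff_coloops_eq hzK, Finset.card_insert_of_notMem (fun h => hzB (Finset.mem_sdiff.1 h).1)]
    omega
  have hR3 : 3 ≤ R.card := by omega
  have hsub : coloops M (insert z B \ coloops M G) ⊆ (insert z B \ coloops M G) \ R := by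
    intro u hu
    rw [mem_coloops] at hu
    rw [Finset.mem_sdiff]
    refine ⟨hu.1, fun huR => hu.2 ?_⟩
    have h2 : 1 < (R.erase u).card := by
      rw [Finset.card_erase_of_mem huR]
      omega
    obtain ⟨r₁, hr₁, r₂, hr₂, hne⟩ := Finset.one_lt_card.1 h2
    have hr₁R := Finset.mem_of_mem_erase hr₁
    have hr₂R := Finset.mem_of_mem_erase hr₂
    have hpair : ({r₁, r₂} : Finset α) ⊆ gr M := by
      intro e he
      rw [Finset.mem_insert, Finset.mem_singleton] at he
      rcases he with rfl | rfl
      · exact hRg hr₁R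
      · exact hRg hr₂R
    have hRline : R ⊆ clF M {r₁, r₂} :=
      subset_clF_of_rkN_le_two_of_two_mem hs hRg hR2.le hr₁R hr₂R hne
        (subset_clF_of_subset_gr hpair (Finset.mem_insert_self _ _))
        (subset_clF_of_subset_gr hpair (Finset.mem_insert_of_mem (Finset.mem_singleton_self _)))
    have hpairQ : ({r₁, r₂} : Finset α) ⊆ (insert z B \ coloops M G).erase u := by
      intro e he
      rw [Finset.mem_insert, Finset.mem_singleton] at he
      rw [Finset.mem_erase]
      rcases he with rfl | rfl
      · exact ⟨(Finset.mem_erase.1 hr₁).1, hRQ hr₁R⟩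
      · exact ⟨(Finset.mem_erase.1 hr₂).1, hRQ hr₂R⟩
    exact clF_mono hpairQ (hRline huR)
  apply Finset.eq_of_subset_of_card_le hsub
  rw [Finset.card_sdiff_of_subset hRQ, h3]
  omega

/-- **Two faces meet in the plane through the line and the third coloop**: a point of `G ∖ K` in the closures of the faces at
two distinct coloops `c ≠ d` of `Q_b ∖ K` lies in `cl ((Q_b ∖ K) ∖ {c, d})`. -/
theorem mem_clF_sdiff_of_mem_two_faces (hG : G ∈ flatsQ M (5 + 1)) (hd : (gr M \ G).card = 2)
    (hk : kColoops M G = 1) {B : Finset α} (hB : B ∈ thinMembers M 5 G) {z : α} (hz : z ∈ G \ clF M B)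
    {c d : α} (hc : c ∈ coloops M (insert z B \ coloops M G)) (hd' : d ∈ coloops M (insert z B \ coloops M G))
    (hcd : c ≠ d) {x : α} (hx : x ∈ G \ coloops M G) (hxc : x ∈ clF M ((insert z B).erase c))
    (hxd : x ∈ clF M ((insert z B).erase d)) :
    x ∈ clF M ((insert z B \ coloops M G) \ {c, d}) := by
  have hGg : G ⊆ gr M := (mem_flatsQ.1 hG).1
  have hQG : insert z B ⊆ G :=
    Finset.insert_subset (Finset.mem_sdiff.1 hz).1 (subset_G_of_mem_thinMembers hB)
  have hQg : insert z B ⊆ gr M := hQG.trans hGg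
  have hKB : coloops M G ⊆ B := coloops_subset_of_mem_thinMembers hG (by omega) hB
  obtain ⟨e₀, he₀⟩ := Finset.card_eq_one.1 (show (coloops M G).card = 1 by
    rw [← kColoops_eq_card_coloops]; exact hk)
  have he₀c : e₀ ∈ coloops M G := he₀ ▸ Finset.mem_singleton_self e₀
  have he₀Q : e₀ ∈ insert z B := Finset.mem_insert_of_mem (hKB he₀c)
  have hcQ : c ∈ insert z B := (Finset.mem_sdiff.1 (mem_coloops.1 hc).1).1
  have hdQ : d ∈ insert z B := (Finset.mem_sdiff.1 (mem_coloops.1 hd').1).1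
  have hcK : c ∉ coloops M G := (Finset.mem_sdiff.1 (mem_coloops.1 hc).1).2
  have hdK : d ∉ coloops M G := (Finset.mem_sdiff.1 (mem_coloops.1 hd').1).2
  have hce₀ : c ≠ e₀ := fun h => hcK (h ▸ he₀c)
  have hde₀ : d ≠ e₀ := fun h => hdK (h ▸ he₀c)
  have h6 : rkN M (insert z B) = 6 := rkN_insert_eq_six_of_thin hG hB hz
  -- the off-coloop erasures: `(Q.erase c) \ K = Q' .erase c`
  have herase : ∀ u : α, u ∉ coloops M G → ((insert z B).erase u).erase e₀ = (insert z B \ coloops M G).erase u := by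
    intro u hu
    ext v
    simp only [Finset.mem_erase, Finset.mem_sdiff, he₀, Finset.mem_singleton]
    tauto
  -- a coloop `u` of `Q'` is off the closure of `Q.erase u`
  have hcol : ∀ u ∈ coloops M (insert z B \ coloops M G), u ∉ clF M ((insert z B).erase u) := by
    intro u hu huc
    have hu' := mem_coloops.1 hu
    have huG : u ∈ G := hQG (Finset.mem_sdiff.1 hu'.1).1
    have hue₀ : u ≠ e₀ := fun h => (Finset.mem_sdiff.1 hu'.1).2 (h ▸ he₀c)
    have h := mem_clF_erase_coloop_of_mem_clF hG he₀c ((Finset.erase_subset _ _).trans hQG) huG hue₀ huc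
    rw [herase u (Finset.mem_sdiff.1 hu'.1).2] at h
    exact hu'.2 h
  have hrkc : rkN M ((insert z B).erase c) = 5 := by
    have h := rkN_insert_eq_add_one_of_notMem_clF ((Finset.erase_subset _ _).trans hQg) (hQg hcQ) (hcol c hc)
    rw [Finset.insert_erase hcQ, h6] at h
    omega
  have hrkd : rkN M ((insert z B).erase d) = 5 := by
    have h := rkN_insert_eq_add_one_of_notMem_clF ((Finset.erase_subset _ _).trans hQg) (hQg hdQ) (hcol d hd')
    rw [Finset.insert_erase hdQ, h6] at h
    omega
  -- `X = Q ∖ {c, d}` has rank `4`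
  set X : Finset α := (insert z B).erase c \ {d} with hX
  have hXsub : X ⊆ (insert z B).erase c := Finset.sdiff_subset
  have hXg : X ⊆ gr M := hXsub.trans ((Finset.erase_subset _ _).trans hQg)
  have hdX : d ∉ X := by
    rw [hX, Finset.mem_sdiff, Finset.mem_singleton]
    tauto
  have hinsX : insert d X = (insert z B).erase c := by
    rw [hX]
    ext v
    simp only [Finset.mem_insert, Finset.mem_sdiff, Finset.mem_singleton, Finset.mem_erase]
    constructor
    · rintro (rfl | ⟨⟨h1, h2⟩, -⟩)
      · exact ⟨Ne.symm hcd, Finset.mem_insert.1 hdQ⟩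
      · exact ⟨h1, h2⟩
    · rintro ⟨h1, h2⟩
      by_cases hv : v = d
      · exact Or.inl hv
      · exact Or.inr ⟨⟨h1, h2⟩, hv⟩
  have hdX' : d ∉ clF M X := by
    intro hdX'
    apply hcol d hd'
    apply clF_mono _ hdX'
    intro v hv
    rw [hX, Finset.mem_sdiff, Finset.mem_singleton] at hv
    rw [Finset.mem_erase]
    exact ⟨hv.2, (Finset.mem_erase.1 hv.1).2⟩
  have hrkX : rkN M X = 4 := by
    have h := rkN_insert_eq_add_one_of_notMem_clF hXg (hQg hdQ) hdX'
    rw [hinsX, hrkc] at h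
    omega
  -- submodularity on the two face closures
  set Y : Finset α := clF M ((insert z B).erase c) ∩ clF M ((insert z B).erase d) with hY
  have hYg : Y ⊆ gr M := fun v hv => mem_gr_of_mem_clF (Finset.mem_inter.1 hv).1
  have hunion : insert z B ⊆ clF M ((insert z B).erase c) ∪ clF M ((insert z B).erase d) := by
    intro v hv
    rw [Finset.mem_union]
    by_cases hvc : v = c
    · right
      subst hvc
      exact subset_clF_of_subset_gr ((Finset.erase_subset _ _).trans hQg) (Finset.mem_erase.2 ⟨hcd, hv⟩)
    · left
      exact subset_clF_of_subset_gr ((Finset.erase_subset _ _).trans hQg) (Finset.mem_erase.2 ⟨hvc, hv⟩)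
  have hrkU : 6 ≤ rkN M (clF M ((insert z B).erase c) ∪ clF M ((insert z B).erase d)) := by
    rw [← h6]
    exact rkN_mono hunion
  have hsub := rkN_submod (M := M) (clF M ((insert z B).erase c)) (clF M ((insert z B).erase d))
  rw [rkN_clF, rkN_clF, hrkc, hrkd] at hsub
  have hrkY : rkN M Y ≤ 4 := by
    rw [hY]
    omega
  have hXY : X ⊆ clF M Y := by
    intro v hv
    apply subset_clF_of_subset_gr hYg
    rw [hY, Finset.mem_inter]
    refine ⟨subset_clF_of_subset_gr ((Finset.erase_subset _ _).trans hQg) (hXsub hv), ?_⟩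
    apply subset_clF_of_subset_gr ((Finset.erase_subset _ _).trans hQg)
    rw [Finset.mem_erase]
    rw [hX, Finset.mem_sdiff, Finset.mem_singleton] at hv
    exact ⟨hv.2, (Finset.mem_erase.1 hv.1).2⟩
  have hcl : clF M X = clF M Y := clF_eq_clF_of_subset_clF_of_rkN_le hYg hXY (by omega)
  have hxY : x ∈ clF M X := by
    rw [hcl]
    exact subset_clF_of_subset_gr hYg (Finset.mem_inter.2 ⟨hxc, hxd⟩)
  -- remove the coloop `e₀`
  have hxG : x ∈ G := (Finset.mem_sdiff.1 hx).1
  have hxe₀ : x ≠ e₀ := fun h => (Finset.mem_sdiff.1 hx).2 (h ▸ he₀c)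
  have hXG : X ⊆ G := fun v hv => hQG (Finset.mem_of_mem_erase (hXsub hv))
  have h := mem_clF_erase_coloop_of_mem_clF hG he₀c hXG hxG hxe₀ hxY
  have heq : X.erase e₀ = (insert z B \ coloops M G) \ {c, d} := by
    rw [hX]
    ext v
    simp only [Finset.mem_erase, Finset.mem_sdiff, Finset.mem_singleton, Finset.mem_insert, he₀, not_or]
    tauto
  rw [heq] at h
  exact h

omit [DecidableEq α] in
/-- The six "third point" inclusions: with `Q′ ⊆ R ∪ {c, d, e}`, the complement of two of the points lies in the line plus
the third. -/
theorem sdiff_pair_subset_insert [DecidableEq α] {Q' R : Finset α} {c d e : α}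
    (hmem : ∀ w ∈ Q', w ∈ R ∨ w = c ∨ w = d ∨ w = e) :
    Q' \ {c, d} ⊆ insert e R ∧ Q' \ {d, c} ⊆ insert e R ∧ Q' \ {c, e} ⊆ insert d R ∧ Q' \ {e, c} ⊆ insert d R ∧
      Q' \ {d, e} ⊆ insert c R ∧ Q' \ {e, d} ⊆ insert c R := by
  refine ⟨?_, ?_, ?_, ?_, ?_, ?_⟩ <;>
  · intro w hw
    rw [Finset.mem_sdiff, Finset.mem_insert, Finset.mem_singleton, not_or] at hw
    rw [Finset.mem_insert]
    rcases hmem w hw.1 with h | h | h | h <;> tauto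

/-- **With no good point, `V` is three-planar**: every point of `V` off `Q_b` lies in two faces, hence on the plane through
the line and the third coloop; the points of `Q_b ∖ K` lie on the line or are the coloops themselves. -/
theorem threePlanar_of_gtPts_eq_empty (hG : G ∈ flatsQ M (5 + 1)) (hd : (gr M \ G).card = 2)
    (hk : kColoops M G = 1) (hs : ∀ e ∈ gr M, ∀ f ∈ gr M, e ≠ f → rkN M {e, f} = 2)
    (hl : ∀ e ∈ gr M, M.Indep {e}) {B : Finset α} (hB : B ∈ thinMembers M 5 G)
    (hbig : 5 ≤ (B \ coloops M G).card) {z : α} (hz : z ∈ G \ clF M B) (hloss : loss M 5 G B z ≠ 0)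
    (hempty : gtPts M 5 G (insert z B) = ∅) :
    (∃ R ⊆ G \ coloops M G, rkN M R = 2 ∧ ∃ c ∈ G \ coloops M G, ∃ d ∈ G \ coloops M G,
      ∃ e ∈ G \ coloops M G, G \ coloops M G ⊆ clF M (insert c R) ∪ clF M (insert d R) ∪ clF M (insert e R)) := by
  obtain ⟨R, hRQ, hR2, hRcard⟩ := exists_rank_two_of_loss_ne_zero hG hd hk hs hl hB hbig hz hloss
  have hcol := coloops_eq_sdiff_of_loss_ne_zero hG hd hk hs hl hB hbig hz hloss hRQ hR2 hRcard
  have h3 := card_coloops_eq_three_of_loss_ne_zero hG hd hk hs hl hB hbig hz hloss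
  obtain ⟨c, d, e, hcd, hce, hde, hC⟩ := Finset.card_eq_three.1 h3
  have hfaces := thinFacesOf_eq_image_erase hG hd hk hs hl hB hbig hz hloss
  have hGg : G ⊆ gr M := (mem_flatsQ.1 hG).1
  have hQG : insert z B ⊆ G :=
    Finset.insert_subset (Finset.mem_sdiff.1 hz).1 (subset_G_of_mem_thinMembers hB)
  have hKB : coloops M G ⊆ B := coloops_subset_of_mem_thinMembers hG (by omega) hB
  have hQ'V : insert z B \ coloops M G ⊆ G \ coloops M G := fun w hw =>
    Finset.mem_sdiff.2 ⟨hQG (Finset.mem_sdiff.1 hw).1, (Finset.mem_sdiff.1 hw).2⟩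
  have hVg : G \ coloops M G ⊆ gr M := Finset.sdiff_subset.trans hGg
  have hmemC : ∀ w, w ∈ coloops M (insert z B \ coloops M G) ↔ w = c ∨ w = d ∨ w = e := by
    intro w
    rw [hC, Finset.mem_insert, Finset.mem_insert, Finset.mem_singleton]
  have hcQ : c ∈ insert z B \ coloops M G := (mem_coloops.1 ((hmemC c).2 (Or.inl rfl))).1
  have hdQ : d ∈ insert z B \ coloops M G := (mem_coloops.1 ((hmemC d).2 (Or.inr (Or.inl rfl)))).1
  have heQ : e ∈ insert z B \ coloops M G := (mem_coloops.1 ((hmemC e).2 (Or.inr (Or.inr rfl)))).1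
  have hmem : ∀ w ∈ insert z B \ coloops M G, w ∈ R ∨ w = c ∨ w = d ∨ w = e := by
    intro w hw
    by_cases hwR : w ∈ R
    · exact Or.inl hwR
    · right
      rw [← hmemC, hcol, Finset.mem_sdiff]
      exact ⟨hw, hwR⟩
  obtain ⟨h1, h2, h3', h4, h5, h6⟩ := sdiff_pair_subset_insert hmem
  have hins : ∀ u : α, u ∈ G \ coloops M G → insert u R ⊆ gr M := fun u hu =>
    Finset.insert_subset (hVg hu) (hRQ.trans (hQ'V.trans hVg))
  refine ⟨R, hRQ.trans hQ'V, hR2, c, hQ'V hcQ, d, hQ'V hdQ, e, hQ'V heQ, ?_⟩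
  intro x hx
  rw [Finset.mem_union, Finset.mem_union]
  by_cases hxQ : x ∈ insert z B
  · have hxQ' : x ∈ insert z B \ coloops M G := Finset.mem_sdiff.2 ⟨hxQ, (Finset.mem_sdiff.1 hx).2⟩
    rcases hmem x hxQ' with h | rfl | rfl | rfl
    · exact Or.inl (Or.inl (subset_clF_of_subset_gr (hins c (hQ'V hcQ)) (Finset.mem_insert_of_mem h)))
    · exact Or.inl (Or.inl (subset_clF_of_subset_gr (hins x hx) (Finset.mem_insert_self _ _)))
    · exact Or.inl (Or.inr (subset_clF_of_subset_gr (hins x hx) (Finset.mem_insert_self _ _)))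
    · exact Or.inr (subset_clF_of_subset_gr (hins x hx) (Finset.mem_insert_self _ _))
  · -- `x` is in no good position: two faces contain it
    have hxg : x ∉ gtPts M 5 G (insert z B) := by
      rw [hempty]
      exact Finset.notMem_empty x
    rw [mem_goodPts, not_and] at hxg
    have h2le : 2 ≤ ((thinFacesOf M 5 G (insert z B)).filter (fun F => x ∈ clF M F)).card := by
      have := hxg (Finset.mem_sdiff.2 ⟨(Finset.mem_sdiff.1 hx).1, hxQ⟩)
      omega
    obtain ⟨F₁, hF₁, F₂, hF₂, hF12⟩ := Finset.one_lt_card.1 h2le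
    rw [Finset.mem_filter, hfaces, Finset.mem_image] at hF₁ hF₂
    obtain ⟨⟨c₁, hc₁, rfl⟩, hx₁⟩ := hF₁
    obtain ⟨⟨c₂, hc₂, rfl⟩, hx₂⟩ := hF₂
    have hc12 : c₁ ≠ c₂ := fun h => hF12 (by rw [h])
    have hplane := mem_clF_sdiff_of_mem_two_faces hG hd hk hB hz hc₁ hc₂ hc12 hx hx₁ hx₂
    rcases (hmemC c₁).1 hc₁ with rfl | rfl | rfl <;> rcases (hmemC c₂).1 hc₂ with rfl | rfl | rfl
    · exact absurd rfl hc12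
    · exact Or.inr (clF_mono h1 hplane)
    · exact Or.inl (Or.inr (clF_mono h3' hplane))
    · exact Or.inr (clF_mono h2 hplane)
    · exact absurd rfl hc12
    · exact Or.inl (Or.inl (clF_mono h5 hplane))
    · exact Or.inl (Or.inr (clF_mono h4 hplane))
    · exact Or.inl (Or.inl (clF_mono h6 hplane))
    · exact absurd rfl hc12

/-- **Unless `V` is three-planar, every load is a distance-1 load**: a good target of a lossy big pair. -/
theorem exists_good_of_dload_ne_zero_of_not_threePlanar (hG : G ∈ flatsQ M (5 + 1)) (hd : (gr M \ G).card = 2)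
    (hk : kColoops M G = 1) (hs : ∀ e ∈ gr M, ∀ f ∈ gr M, e ≠ f → rkN M {e, f} = 2)
    (hl : ∀ e ∈ gr M, M.Indep {e}) (hfat : (fatClosures M 5 G 2).card ≤ 1)
    (hntp : ¬ (∃ R ⊆ G \ coloops M G, rkN M R = 2 ∧ ∃ c ∈ G \ coloops M G, ∃ d ∈ G \ coloops M G,
      ∃ e ∈ G \ coloops M G, G \ coloops M G ⊆ clF M (insert c R) ∪ clF M (insert d R) ∪ clF M (insert e R)))
    {T : Finset α} (hne : dload M 5 G (bigP M G) (dshGT2 M 5 G) T ≠ 0) :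
    ∃ B ∈ thinMembers M 5 G, 5 ≤ (B \ coloops M G).card ∧ ∃ z ∈ G \ clF M B, loss M 5 G B z ≠ 0 ∧
      ∃ x ∈ gtPts M 5 G (insert z B), T = insert x (insert z B) := by
  obtain ⟨B, hB, hbig, z, hz, hloss, hcase⟩ := exists_pair_of_dload_ne_zero' hG hd hk hs hl hfat hne
  rcases hcase with ⟨-, x, hx, rfl⟩ | ⟨hno, -⟩
  · exact ⟨B, hB, hbig, z, hz, hloss, x, hx, rfl⟩
  · exact absurd (threePlanar_of_gtPts_eq_empty hG hd hk hs hl hB hbig hz hloss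
      (Finset.not_nonempty_iff_eq_empty.1 hno)) hntp

end PercRepro.Shadow
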